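import Literature.IUT.LogThetaLattice.DHodgeTheaterSignSynchronization
import Literature.IUT.HodgeTheaters.PMBaseBridgePropsProofs5

/-!
# The representative-level `{±1}`-symmetry of a `𝒟-Θ^{±ell}`-Hodge theater, and the exact image of `†ℋ𝒯 ↦ †𝔇_≻` on isomorphisms ([IUTchI] Examples 6.2 (ii), 6.3 (ii), Def 6.4 (iii); [IUTchIII] Prop 1.3 (i), Rmk 1.3.1)

Mochizuki, *Inter-universal Teichmüller Theory I*, kurims manuscript (May 2020), §6, Example 6.2 (ii) p.160 (the
poly-automorphism `−1_{𝔽_l}`), Example 6.3 (ii) p.161 (the poly-action of `𝔽_l^{⋊±}` and the equivariance of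
`φ^{Θell}_±`), Def 6.4 (i)–(iii) pp.162–163; *III*, kurims (May 2020), Prop 1.3 (i) p.42, Rmk 1.3.1 p.43.
PROOF-ONLY companion (theorems, no definitions) by the L6 cone prover abc-iut-w4-d017, sequel to
`DHodgeTheaterSignSynchronization.lean` (this seat, p417155), over abc-iut-L6-t3's `DHodgeTheaterRepIso.lean` /
`DHodgeTheaterGroupoid.lean` and abc-iut-L5-t4's / abc-iut-L5-t13's `PMBase*` files; nothing of theirs is restated.
DAG nodes IUTchIII:Prop1.3(i) / IUTchIII:Thm1.5(i) (plan/L6/SUBDAG-IUTchIII-Prop-13.md row Prop-13.i.r4a).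
([IUTchI] Def 6.4 (iii) p.163) [claim: Mochizuki2012, status: disputed].

INPUT BY NAME (abc-iut-L5-t13's standing hypothesis, cf. `PMBaseBridgePropsProofs5`, `PMBaseEllBridgeSymmetryGroup`;
shown NOT to follow from the base interface alone by `Ex63.exists_kit_not_equivariant`): the equivariance of
[IUTchI] Example 6.3 (ii) for NEGATIVE elements, `hE : ∀ γ : FlPM l, γ.IsNegative → Ex63.Equivariant K γ`.

* `DHTRep.DRepIso.exists_negative_model` — GIVEN `hE`, the model `𝒟-Θ^{±ell}`-Hodge theater of Examples 6.2 (i),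
  6.3 (i) (`Ex62.ht K`) carries a representative automorphism with index bijection `t ↦ −t`, everywhere-NEGATIVE
  capsule and `≻` constituents, and global constituent a lift of `(0, −1) ∈ 𝔽_l^{⋊±}` — the representative-level
  form of `−1_{𝔽_l}` [Ex 6.2 (ii)] glued to the `(0,−1)`-poly-action [Ex 6.3 (ii)] (Def 6.4 (i) compatibility =
  Ex 6.2 (ii) "compatible with `φ^{Θ±}_±`"; Def 6.4 (ii) compatibility = the equivariance `hE`).
* `DHTRep.DRepIso.exists_gLabMap_glob_ne_refl` — hence (given `hE`, `𝕍 ≠ ∅`) EVERY `𝒟-Θ^{±ell}`-Hodge theater admits a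
  representative automorphism moving the cusp labels of `†𝒟^{⊚±}` (transport along `DRepIso.iso_nonempty`), i.e.
  one that is negative at `†𝒟_{≻,v}` for every `v` (`±`-synchronization, p417155).
* `DHTRep.DRepIso.exists_cod_eq_iff_sync` — **THE EXACT IMAGE** (given `hE`): an isomorphism of `𝒟`-prime-strips
  `δ : †𝔇_≻ ⥲ ‡𝔇_≻` is the `≻`-constituent of a representative `†ℋ𝒯 ⥲ ‡ℋ𝒯` IFF its sign relative to one (any)
  induced isomorphism is the same at all `v ∈ 𝕍` — exactly 2 of the `2^𝕍` `+`-full poly-isomorphisms `†𝔇_≻ ⥲ ‡𝔇_≻`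
  (Def 6.1 (iv)) are induced: the `±`-synchronized ones ([IUTchIII] Rmk 1.3.1 p.43, paraphrase: the
  `𝔽_l^{⋊±}`-symmetry synchronizes the `±`-indeterminacies across `𝕍`).
HONEST FRAMING: consequences of the typed definitions plus the named input `hE`; no new `Prop` fact; nothing here
bears on [IUTchIII] Cor 3.12; typed ≠ proved for the series' claims; no side taken.
-/

namespace Literature.IUT.LogThetaLattice

open CategoryTheory
open Literature.IUT.HodgeTheaters Literature.IUT.HodgeTheaters.PMBaseKit

universe u

variable {l : ℕ} {K : PMBaseKit.{u} l}

namespace DHTRep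

namespace DRepIso

variable {H H₁ H₂ : K.DThetaPMEllHT}

/-- **IUTchI:Ex6.2(ii)** (kurims p.160) **The `{±1}`-symmetry of the MODEL `𝒟-Θ^{±ell}`-Hodge theater, representative level.** Given
the equivariance of Example 6.3 (ii) for negative elements, the model `(𝔇_≻ ⟵ 𝔇_± ⟶ 𝒟^{⊚±})` of Examples 6.2 (i) /
6.3 (i) carries a representative automorphism with index bijection `t ↦ −t` ("`−1_{𝔽_l}` … acts on `𝔽_l` as
multiplication by `−1` and induces the poly-isomorphisms `𝔇_t ⥲ 𝔇_{−t}` and `𝔇_≻ ⥲ 𝔇_≻` determined by the `+`-full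
poly-automorphism whose sign at every `v ∈ 𝕍` is negative", Ex 6.2 (ii)), whose global constituent is a lift of
`(0, −1) ∈ 𝔽_l^{⋊±}` and hence MOVES the cusp labels of `𝒟^{⊚±}`.
([IUTchI] Ex 6.2 (ii) p.160) [claim: Mochizuki2012, status: disputed] -/
theorem exists_negative_model [NeZero l] (hl : 2 < l)
    (hE : ∀ γ : FlPM l, γ.IsNegative → Ex63.Equivariant K γ) :
    ∃ a : DRepIso (Ex62.ht K) (Ex62.ht K), K.gLabMap a.glob ≠ Equiv.refl _ := by
  -- an everywhere-negative automorphism of the tautological strip, and a lift of `(0, −1)`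
  obtain ⟨n, hn⟩ := DStrip.exists_mem_signedPolyAut (DStrip.model K) (fun _ => (-1 : ℤˣ))
  obtain ⟨b₀, hb₀⟩ := Ex63.lifts_nonempty (K := K) (FlPM.mk 0 (-1))
  have hneg : ∀ v, K.labMap v (n v) ≠ Equiv.refl _ := fun v h =>
    absurd (((DStrip.mem_signedPolyAut_iff _ _).mp hn v).mp h) (by decide)
  have hEq := hE (FlPM.mk 0 (-1)) rfl
  refine ⟨ofTransport (Equiv.neg (ZMod l)) ?_ (fun _ => n) n b₀ ?_ ?_, ?_⟩
  · -- `t ↦ −t` is an isomorphism of the tautological `𝔽_l^±`-group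
    rintro e ⟨ε, rfl⟩
    refine ⟨-ε, ?_⟩
    ext z
    show (-ε) • z = ε • (-z)
    rw [smul_neg, Units.neg_smul]
  · -- Def 6.4 (i): `φ^{Θ±}_{−t}` and `φ^{Θ±}_t` are the positive `+`-full poly-isomorphisms (Ex 6.2 (ii))
    show ∀ t : ZMod l, DStrip.polyComp (DStrip.plusFullPolyIso n) (Ex62.poly K (-t)) =
      DStrip.polyComp (Ex62.poly K t) (DStrip.plusFullPolyIso n)
    intro t
    rw [Ex62.poly_eq, Ex62.poly_eq, DStrip.polyComp_plusFullPolyIso, DStrip.polyComp_plusFullPolyIso]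
    congr 1
    funext v
    exact (Iso.trans_refl _).trans (Iso.refl_trans _).symm
  · -- Def 6.4 (ii) in transport form, from the equivariance of Ex 6.3 (ii) for `(0, −1)`
    show ∀ (t : ZMod l) (v : K.V) (k : K.model v ⟶ (K.atV v).obj K.gModel),
      k ∈ Ex63.poly K (-t) v ↔ (n v).hom ≫ k ≫ (K.atV v).map b₀.inv ∈ Ex63.poly K t v
    intro t v k
    have hEtv := hEq t v
    have ht : (FlPM.mk (0 : ZMod l) (-1)) • t = -t := by simp [FlPM.mk_smul]
    change {h | ∃ f ∈ Ex63.poly K t v, ∃ b ∈ Ex63.lifts K (FlPM.mk 0 (-1)), h = f ≫ (K.atV v).map b.hom} =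
      {h | ∃ p ∈ (DStrip.model K).signedPolyAut (fun _ => (-1 : ℤˣ)),
        ∃ g ∈ Ex63.poly K ((FlPM.mk (0 : ZMod l) (-1)) • t) v, h = (p v).hom ≫ g} at hEtv
    rw [ht] at hEtv
    constructor
    · intro hk
      have hmem : (n v).hom ≫ k ∈ {h | ∃ f ∈ Ex63.poly K t v, ∃ b ∈ Ex63.lifts K (FlPM.mk 0 (-1)),
          h = f ≫ (K.atV v).map b.hom} := by
        rw [hEtv]
        exact ⟨n, hn, k, hk, rfl⟩
      obtain ⟨f, hf, b, hb, hfb⟩ := hmem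
      obtain ⟨c, hc, rfl⟩ := Ex63.exists_csp_of_mem_lifts hb₀ hb
      obtain ⟨a, ha, b', hb', rfl⟩ := hf
      refine ⟨a, ha, b' ≪≫ (b₀ ≪≫ c ≪≫ b₀.symm), Ex63.trans_csp_mem_lifts hb' (conj_mem_autCsp b₀ hc), ?_⟩
      rw [reassoc_of% hfb]
      simp [← Functor.map_comp]
    · intro hk
      have hmem : ((n v).hom ≫ k ≫ (K.atV v).map b₀.inv) ≫ (K.atV v).map b₀.hom ∈
          {h | ∃ p ∈ (DStrip.model K).signedPolyAut (fun _ => (-1 : ℤˣ)),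
            ∃ g ∈ Ex63.poly K (-t) v, h = (p v).hom ≫ g} := by
        rw [← hEtv]
        exact ⟨_, hk, b₀, hb₀, rfl⟩
      obtain ⟨p, hp, g, hg, hpg⟩ := hmem
      have hpv : K.labMap v (p v) ≠ Equiv.refl _ := fun h =>
        absurd (((DStrip.mem_signedPolyAut_iff _ _).mp hp v).mp h) (by decide)
      have hk' : k = ((n v).symm ≪≫ p v).hom ≫ g := by
        have h1 : (n v).hom ≫ k = (p v).hom ≫ g := by
          simpa only [Category.assoc, ← Functor.map_comp, Iso.inv_hom_id, CategoryTheory.Functor.map_id,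
            Category.comp_id] using hpg
        have h2 := congrArg ((n v).inv ≫ ·) h1
        simpa only [Iso.inv_hom_id_assoc, Iso.trans_hom, Iso.symm_hom, Category.assoc] using h2
      rw [hk']
      refine Ex63.pre_mem_poly ?_ hg
      rw [labMap_trans_eq_refl_iff (K.isLocal_model v), labMap_symm]
      constructor
      · intro h
        exact absurd (by simpa only [Equiv.symm_symm, Equiv.refl_symm] using congrArg Equiv.symm h) (hneg v)
      · intro h
        exact absurd h hpv
  · -- the global constituent is a lift of `(0, −1)`: it acts on cusp labels by `z ↦ −z`, not trivially
    intro h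
    have hb : K.gLabMap b₀ = K.gChart₀.trans ((FlPM.toPerm l (FlPM.mk 0 (-1))).trans K.gChart₀.symm) := hb₀.2
    change K.gLabMap b₀ = Equiv.refl _ at h
    rw [h] at hb
    have h1 := congrArg (fun e => K.gChart₀ (e (K.gChart₀.symm 1))) hb
    simp only [Equiv.refl_apply, Equiv.trans_apply, Equiv.apply_symm_apply, FlPM.toPerm_apply, FlPM.mk_smul,
      Units.neg_smul, one_smul, add_zero] at h1
    haveI : Fact (2 < l) := ⟨hl⟩
    exact ZMod.neg_one_ne_one h1.symm

/-- **IUTchI:Def6.4(iii)** (kurims p.163) **Every `𝒟-Θ^{±ell}`-Hodge theater admits a representative automorphism moving the cusp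
labels of `†𝒟^{⊚±}`** — equivalently (p417155 `labMap_cod_eq_refl_iff_gLabMap_glob`) negative at `†𝒟_{≻,v}` for EVERY
`v` — GIVEN the equivariance of Example 6.3 (ii) for negative elements: transport the model symmetry
(`exists_negative_model`) along a representative `†ℋ𝒯 ⥲` model (`DRepIso.iso_nonempty`, "an isomorph of the model").
([IUTchI] Def 6.4 (iii) p.163) [claim: Mochizuki2012, status: disputed] -/
theorem exists_gLabMap_glob_ne_refl (hE : ∀ γ : FlPM l, γ.IsNegative → Ex63.Equivariant K γ)
    (hV : Nonempty K.V) (H : K.DThetaPMEllHT) :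
    ∃ a : DRepIso H H, K.gLabMap a.glob ≠ Equiv.refl _ := by
  have hl : 2 < l := DThetaPMEllHT.two_lt_of_nonempty hV H
  haveI : NeZero l := ⟨by omega⟩
  obtain ⟨a₀, ha₀⟩ := exists_negative_model (K := K) hl hE
  obtain ⟨r⟩ := DRepIso.iso_nonempty H (Ex62.ht K)
  refine ⟨r.trans (a₀.trans r.symm), fun h => ha₀ (Equiv.ext fun x => ?_)⟩
  change K.gLabMap (r.glob ≪≫ (a₀.glob ≪≫ r.glob.symm)) = Equiv.refl _ at h
  rw [K.gLabMap_trans, K.gLabMap_trans, gLabMap_symm] at h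
  have hx := Equiv.ext_iff.mp h ((K.gLabMap r.glob).symm x)
  simp only [Equiv.trans_apply, Equiv.apply_symm_apply, Equiv.refl_apply] at hx
  simpa only [Equiv.refl_apply] using (K.gLabMap r.glob).symm.injective hx

/-- **IUTchI:Def6.4(iii)** (kurims p.163) … hence a representative automorphism that is NEGATIVE at `†𝒟_{≻,v}` for every `v ∈ 𝕍`
(given the equivariance of Example 6.3 (ii)). ([IUTchI] Def 6.4 (iii) p.163) [claim: Mochizuki2012, status: disputed] -/
theorem exists_forall_labMap_cod_ne_refl (hE : ∀ γ : FlPM l, γ.IsNegative → Ex63.Equivariant K γ)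
    (hV : Nonempty K.V) (H : K.DThetaPMEllHT) :
    ∃ a : DRepIso H H, ∀ v, K.labMap v (a.cod v) ≠ Equiv.refl _ := by
  obtain ⟨a, ha⟩ := exists_gLabMap_glob_ne_refl hE hV H
  exact ⟨a, fun v hv => ha ((a.labMap_cod_eq_refl_iff_gLabMap_glob v).mp hv)⟩

/-- **IUTchIII:Prop1.3(i)** (kurims p.42) **THE EXACT IMAGE of `Isom(†ℋ𝒯^{𝒟-Θ±ell}, ‡ℋ𝒯^{𝒟-Θ±ell}) → Isom(†𝔇_≻, ‡𝔇_≻)`**, given the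
equivariance of [IUTchI] Example 6.3 (ii): relative to one representative `f`, an isomorphism of `𝒟`-prime-strips
`δ : †𝔇_≻ ⥲ ‡𝔇_≻` is induced by some representative iff `f_≻⁻¹ ∘ δ` is positive at EVERY `v` or negative at EVERY `v` —
the two `±`-synchronized `+`-full poly-isomorphisms among the `2^𝕍` of Def 6.1 (iv) (paraphrase of [IUTchIII] Rmk 1.3.1
p.43: the `𝔽_l^{⋊±}`-symmetry synchronizes the `±`-indeterminacies at the various `v`).
([IUTchIII] Prop 1.3 (i) p.42) [claim: Mochizuki2012, status: disputed] -/
theorem exists_cod_eq_iff_of_equivariant (hE : ∀ γ : FlPM l, γ.IsNegative → Ex63.Equivariant K γ)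
    (f : DRepIso H₁ H₂) (δ : H₁.codomain.Iso H₂.codomain) :
    (∃ g : DRepIso H₁ H₂, g.cod = δ) ↔
      (∀ v, K.labMap v ((f.cod v).symm ≪≫ δ v) = Equiv.refl _) ∨
        ∀ v, K.labMap v ((f.cod v).symm ≪≫ δ v) ≠ Equiv.refl _ := by
  rw [f.exists_cod_eq_iff δ]
  rcases isEmpty_or_nonempty K.V with hV | hV
  · exact ⟨fun _ => Or.inl fun v => isEmptyElim v, fun _ => Or.inl fun v => isEmptyElim v⟩
  · have hne := exists_gLabMap_glob_ne_refl hE hV H₂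
    constructor
    · rintro (h | ⟨-, h⟩)
      · exact Or.inl h
      · exact Or.inr h
    · rintro (h | h)
      · exact Or.inl h
      · exact Or.inr ⟨hne, h⟩

/-- **IUTchIII:Prop1.3(i)** (kurims p.42) Equivalently (given the equivariance of [IUTchI] Example 6.3 (ii)): `δ : †𝔇_≻ ⥲ ‡𝔇_≻` is
induced by a representative `†ℋ𝒯 ⥲ ‡ℋ𝒯` iff its sign relative to an induced one is `v`-INDEPENDENT ("synchronized").
([IUTchIII] Prop 1.3 (i) p.42) [claim: Mochizuki2012, status: disputed] -/
theorem exists_cod_eq_iff_sync (hE : ∀ γ : FlPM l, γ.IsNegative → Ex63.Equivariant K γ)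
    (f : DRepIso H₁ H₂) (δ : H₁.codomain.Iso H₂.codomain) :
    (∃ g : DRepIso H₁ H₂, g.cod = δ) ↔
      ∀ v w, (K.labMap v ((f.cod v).symm ≪≫ δ v) = Equiv.refl _ ↔
        K.labMap w ((f.cod w).symm ≪≫ δ w) = Equiv.refl _) := by
  rw [exists_cod_eq_iff_of_equivariant hE f δ]
  constructor
  · rintro (h | h) v w
    · exact ⟨fun _ => h w, fun _ => h v⟩
    · exact ⟨fun hv => absurd hv (h v), fun hw => absurd hw (h w)⟩
  · intro h
    rcases isEmpty_or_nonempty K.V with hV | ⟨⟨v₀⟩⟩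
    · exact Or.inl fun v => isEmptyElim v
    · by_cases h0 : K.labMap v₀ ((f.cod v₀).symm ≪≫ δ v₀) = Equiv.refl _
      · exact Or.inl fun v => (h v v₀).mpr h0
      · exact Or.inr fun v hv => h0 ((h v v₀).mp hv)

end DRepIso

/-- **IUTchIII:Prop1.3(i)** (kurims p.42) FUNCTOR FORM of the exact image (given the equivariance of [IUTchI] Example 6.3 (ii)): an
isomorphism `†𝔇_≻ ⥲ ‡𝔇_≻` in the groupoid of `𝒟`-prime-strips is `DHTRep.codFunctor.mapIso` of an isomorphism of the
representative-level groupoid iff its sign relative to the image of one (any) isomorphism is synchronized across `𝕍`.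
([IUTchIII] Prop 1.3 (i) p.42) [claim: Mochizuki2012, status: disputed] -/
theorem codFunctor_mapIso_mem_range_iff (hE : ∀ γ : FlPM l, γ.IsNegative → Ex63.Equivariant K γ)
    {X Y : DHTRep K} (ξ₀ : X ≅ Y) (e : DHTRep.codFunctor.obj X ≅ DHTRep.codFunctor.obj Y) :
    e ∈ Set.range (fun ξ : X ≅ Y => DHTRep.codFunctor.mapIso ξ) ↔
      ∀ v w, (K.labMap v ((ξ₀.hom.cod v).symm ≪≫ e.hom v) = Equiv.refl _ ↔
        K.labMap w ((ξ₀.hom.cod w).symm ≪≫ e.hom w) = Equiv.refl _) := by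
  refine Iff.trans ?_ (DRepIso.exists_cod_eq_iff_sync hE ξ₀.hom e.hom)
  constructor
  · rintro ⟨ξ, hξ⟩
    exact ⟨ξ.hom, by rw [← hξ]; rfl⟩
  · rintro ⟨g, hg⟩
    refine ⟨Groupoid.isoEquivHom X Y |>.symm g, Iso.ext ?_⟩
    show (Groupoid.isoEquivHom X Y |>.symm g).hom.cod = e.hom
    rw [← hg]
    rfl

end DHTRep

end Literature.IUT.LogThetaLattice
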